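import Summits.NavierStokesRegularity.FluidComputer.ModulatedCollapseGaugeRigidity
import HarnessLib

/-!
# Gauge rigidity of the modulated one-profile collapse — LOCAL form (parabolic neighbourhood of
# the singular point)

Summit `NavierStokesRegularity`, cell topic directory `FluidComputer`, namespace
`…FluidComputer.SelfSimilarCensus`; sequel of `ModulatedCollapseGaugeRigidity.lean`, which asks the
momentum equation on whole time slices `(T₀, T) × E`. A blow-up profile is a LOCAL object: here the
exact one-profile modulated ansatz `u(t, x) = λ(t) • U(λ(t) • x)`, `p(t, x) = λ(t)² P(λ(t) • x)` is
only assumed to satisfy `∂ₜu + (u·∇)u + ∇p − νΔu = 0` on a parabolic neighbourhood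
`{T₀ < t < T} × B(0, r)` of the singular point `(T, 0)`, with the clock `λ > 0` differentiable and
blowing up, `λ(t) → +∞` as `t ↑ T` (so that `y = λ(t) x` sweeps every point of `E` as `t ↑ T`:
`eventually_twoTerm_of_momentum_ball`). CONCLUSION (`modulatedCollapse_rigidity_local`): EITHER
`U ≡ 0`, OR on some terminal interval `(T₁, T)` the clock is Leray's, `λ(t) = (2a(T−t))^{-1/2}` with
`a > 0` — equivalently `(T − t)λ(t)²` is constant near `T` (`sub_mul_sq_eventually_const`): a
logarithmic (or any other) correction to the parabolic gauge is excluded for exact one-profile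
collapses already by the equation NEAR the singular point. Same elementary argument as the global
file (two-term identity at each fixed `y` for `t` close to `T`, one linear-independence step, Euler's
degree-`(−1)` homogeneity lemma, the affine clock law); PROVED theorems only, no definitions, no
named facts.

WHAT THIS IS NOT: not a statement about similarity-time dependent (DSS / drifting) profiles, not a
regularity theorem, not Navier–Stokes evidence; «violates: none — no object».

References: J. Leray, Acta Math. 63 (1934), §20, (3.11)–(3.12) [Leray1934]; J. Nečas, M. Růžička,
V. Šverák, Acta Math. 176 (1996), Introduction [NecasRuzickaSverak1996].
-/

noncomputable section

open Set Filter Topology InnerProductSpace Metric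
open scoped Laplacian RealInnerProductSpace

namespace Summit.NavierStokesRegularity.FluidComputer.SelfSimilarCensus

open Literature.Analysis.FluidPDE

section Local

variable {E : Type*} [NormedAddCommGroup E] [InnerProductSpace ℝ E] [FiniteDimensional ℝ E]
variable {U : E → E} {P : E → ℝ} {lam lam' : ℝ → ℝ} {ν T₀ T r : ℝ}

omit [InnerProductSpace ℝ E] [FiniteDimensional ℝ E] in
/-- **The rescaled point enters the ball.** If `λ(t) → +∞` as `t ↑ T` and `r > 0`, then for every
`y ∈ E` eventually (as `t ↑ T`) `λ(t) > 0` and `λ(t)⁻¹ • y ∈ B(0, r)`. [folklore] -/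
theorem eventually_inv_smul_mem_ball [NormedSpace ℝ E] (hblow : Tendsto lam (𝓝[<] T) atTop)
    (hr : 0 < r) (y : E) :
    ∀ᶠ t in 𝓝[<] T, 0 < lam t ∧ (lam t)⁻¹ • y ∈ ball (0 : E) r := by
  filter_upwards [hblow.eventually_gt_atTop (max 0 (‖y‖ / r))] with t ht
  have h0 : 0 < lam t := lt_of_le_of_lt (le_max_left _ _) ht
  have h1 : ‖y‖ / r < lam t := lt_of_le_of_lt (le_max_right _ _) ht
  refine ⟨h0, ?_⟩
  rw [mem_ball_zero_iff, norm_smul, norm_inv, Real.norm_of_nonneg h0.le]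
  rw [div_lt_iff₀ hr] at h1
  calc (lam t)⁻¹ * ‖y‖ < (lam t)⁻¹ * (lam t * r) := by
        exact mul_lt_mul_of_pos_left h1 (inv_pos.2 h0)
    _ = r := by field_simp

/-! Standing hypotheses: `T₀ < T`, `r > 0`; on `(T₀, T)` the clock `λ` is differentiable with
derivative `λ′` and positive, and `λ(t) → +∞` as `t ↑ T`; `U ∈ C¹(E; E)`; the ansatz satisfies
the momentum equation on the parabolic neighbourhood `(T₀, T) × B(0, r)` only. -/
variable (hT : T₀ < T) (hr : 0 < r) (hlam : ∀ t ∈ Ioo T₀ T, HasDerivAt lam (lam' t) t)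
  (hpos : ∀ t ∈ Ioo T₀ T, 0 < lam t) (hblow : Tendsto lam (𝓝[<] T) atTop) (hU : ContDiff ℝ 1 U)
  (heq : ∀ t ∈ Ioo T₀ T, ∀ x ∈ ball (0 : E) r,
    timeDeriv (fun s => nsRescaleData (lam s) U) t x +
        convect (nsRescaleData (lam t) U) (nsRescaleData (lam t) U) x +
        gradient (fun y => lam t ^ 2 * P (lam t • y)) x -
        ν • (Δ (nsRescaleData (lam t) U)) x = 0)
include hT hr hlam hpos hblow hU heq

omit hpos in
/-- **The two-term identity at every `y`, for `t` close to `T`.** For each `y ∈ E`, eventually as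
`t ↑ T`: `λ′(t) • (U(y) + DU(y) y) + λ(t)³ • ((U·∇)U(y) + ∇P(y) − νΔU(y)) = 0` (evaluate the
momentum identity `momentum_nsRescaleData` at `x = λ(t)⁻¹ y`, which lies in `B(0, r)` once `λ(t)` is
large). [folklore] -/
theorem eventually_twoTerm_of_momentum_ball (y : E) :
    ∀ᶠ t in 𝓝[<] T, lam' t • (U y + fderiv ℝ U y y) +
      lam t ^ 3 • (convect U U y + gradient P y - ν • (Δ U) y) = 0 := by
  filter_upwards [eventually_inv_smul_mem_ball hblow hr y, Ioo_mem_nhdsLT hT] with t ht htI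
  have hne : lam t ≠ 0 := ht.1.ne'
  have hx := heq t htI ((lam t)⁻¹ • y) ht.2
  rw [momentum_nsRescaleData (hlam t htI) hne hU P ν, smul_smul, mul_inv_cancel₀ hne,
    one_smul] at hx
  exact hx

/-- **Local dichotomy.** EITHER `U + DU[y] ≡ 0` on `E`, OR on some terminal interval `(T₁, T)`,
`T₀ ≤ T₁ < T`, the readout is constant: `λ′ = aλ³` there for one `a : ℝ`. [folklore] -/
theorem scalingGenerator_eq_zero_or_exists_readout_eq_local :
    (∀ y, U y + fderiv ℝ U y y = 0) ∨
      ∃ T₁ a : ℝ, T₀ ≤ T₁ ∧ T₁ < T ∧ ∀ t ∈ Ioo T₁ T, lam' t = a * lam t ^ 3 := by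
  by_cases hW : ∀ y, U y + fderiv ℝ U y y = 0
  · exact Or.inl hW
  · right
    push Not at hW
    obtain ⟨y₀, hy₀⟩ := hW
    -- a terminal interval on which the two-term identity holds at `y₀`
    obtain ⟨T₁', hT₁', hsub⟩ := mem_nhdsLT_iff_exists_Ioo_subset.1
      ((eventually_twoTerm_of_momentum_ball hT hr hlam hblow hU heq y₀).and
        (Ioo_mem_nhdsLT hT))
    set T₁ := max T₀ T₁' with hT₁
    have hT₁T : T₁ < T := max_lt hT hT₁'
    have hIoo : ∀ t ∈ Ioo T₁ T, lam' t • (U y₀ + fderiv ℝ U y₀ y₀) +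
        lam t ^ 3 • (convect U U y₀ + gradient P y₀ - ν • (Δ U) y₀) = 0 ∧ t ∈ Ioo T₀ T :=
      fun t ht => hsub ⟨lt_of_le_of_lt (le_max_right _ _) ht.1, ht.2⟩
    obtain ⟨t₀, ht₀⟩ : (Ioo T₁ T).Nonempty := nonempty_Ioo.2 hT₁T
    refine ⟨T₁, lam' t₀ / lam t₀ ^ 3, le_max_left _ _, hT₁T, fun t ht => ?_⟩
    have hne : ∀ s ∈ Ioo T₁ T, lam s ≠ 0 := fun s hs => (hpos s (hIoo s hs).2).ne'
    -- the one-point family `Unit ↦ (W y₀, N y₀)` feeds the linear-independence step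
    have key := mul_eq_mul_of_twoTerm (S := Ioo T₁ T) (f := lam') (g := fun s => lam s ^ 3)
      (W := fun _ : Unit => U y₀ + fderiv ℝ U y₀ y₀)
      (N := fun _ : Unit => convect U U y₀ + gradient P y₀ - ν • (Δ U) y₀)
      (fun s hs _ => (hIoo s hs).1) (y₀ := ()) hy₀ ht ht₀
    -- `key : lam' t * lam t₀ ^ 3 = lam' t₀ * lam t ^ 3`
    rw [div_mul_eq_mul_div, eq_div_iff (pow_ne_zero 3 (hne t₀ ht₀))]
    exact key

/-- **LOCAL GAUGE RIGIDITY.** Under the standing hypotheses (momentum equation on the parabolic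
neighbourhood `(T₀, T) × B(0, r)` only), EITHER `U ≡ 0` OR there are `T₁ ∈ [T₀, T)` and `a > 0`
with `λ(t) = (2a(T−t))^{-1/2}` for every `t ∈ (T₁, T)`: near the singular time the clock of an exact
one-profile collapse is Leray's — no logarithmic or other correction. [folklore] -/
theorem modulatedCollapse_rigidity_local :
    U = 0 ∨ ∃ T₁ a : ℝ, T₀ ≤ T₁ ∧ T₁ < T ∧ 0 < a ∧
      ∀ t ∈ Ioo T₁ T, lam t = (Real.sqrt (2 * a * (T - t)))⁻¹ := by
  rcases scalingGenerator_eq_zero_or_exists_readout_eq_local hT hr hlam hpos hblow hU heq with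
    hW | ⟨T₁, a, hT₀T₁, hT₁T, ha⟩
  · exact Or.inl (eq_zero_of_scalingGenerator_eq_zero hU hW)
  · right
    have hsubI : Ioo T₁ T ⊆ Ioo T₀ T := Ioo_subset_Ioo_left hT₀T₁
    have hlam₁ : ∀ t ∈ Ioo T₁ T, HasDerivAt lam (lam' t) t := fun t ht => hlam t (hsubI ht)
    have hpos₁ : ∀ t ∈ Ioo T₁ T, 0 < lam t := fun t ht => hpos t (hsubI ht)
    have hne₁ : ∀ t ∈ Ioo T₁ T, lam t ≠ 0 := fun t ht => (hpos₁ t ht).ne'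
    obtain ⟨t₁, ht₁⟩ : (Ioo T₁ T).Nonempty := nonempty_Ioo.2 hT₁T
    exact ⟨T₁, a, hT₀T₁, hT₁T, (inv_sq_eq_leray_of_readout_eq hT₁T hlam₁ hne₁ ha hblow ht₁).1,
      fun t ht => eq_lerayScale_of_readout_eq hT₁T hlam₁ hpos₁ ha hblow ht⟩

/-- **No correction to the parabolic gauge near the singular time.** If `U ≢ 0`, then
`(T − t) λ(t)² = (2a)⁻¹` on a terminal interval `(T₁, T)`: the «modulation relative to Leray» of an
exact one-profile collapse is eventually CONSTANT. [folklore] -/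
theorem sub_mul_sq_eventually_const (hU0 : U ≠ 0) :
    ∃ T₁ a : ℝ, T₀ ≤ T₁ ∧ T₁ < T ∧ 0 < a ∧ ∀ t ∈ Ioo T₁ T, (T - t) * lam t ^ 2 = (2 * a)⁻¹ := by
  rcases modulatedCollapse_rigidity_local hT hr hlam hpos hblow hU heq with
    h0 | ⟨T₁, a, hT₀T₁, hT₁T, ha, h⟩
  · exact absurd h0 hU0
  · refine ⟨T₁, a, hT₀T₁, hT₁T, ha, fun t ht => ?_⟩
    have hTt : T - t ≠ 0 := (sub_pos.2 ht.2).ne'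
    have harg : 0 < 2 * a * (T - t) := mul_pos (mul_pos two_pos ha) (sub_pos.2 ht.2)
    rw [h t ht, inv_pow, Real.sq_sqrt harg.le]
    field_simp

/-- **Near the singular time the collapse IS Leray's backward field**: if `U ≢ 0` there are
`T₁ ∈ [T₀, T)` and `a > 0` with `u(t) = lerayBackward a T U t` for all `t ∈ (T₁, T)`. [folklore] -/
theorem exists_eventually_eq_lerayBackward (hU0 : U ≠ 0) :
    ∃ T₁ a : ℝ, T₀ ≤ T₁ ∧ T₁ < T ∧ 0 < a ∧
      ∀ t ∈ Ioo T₁ T, nsRescaleData (lam t) U = lerayBackward a T U t := by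
  rcases modulatedCollapse_rigidity_local hT hr hlam hpos hblow hU heq with
    h0 | ⟨T₁, a, hT₀T₁, hT₁T, ha, h⟩
  · exact absurd h0 hU0
  · exact ⟨T₁, a, hT₀T₁, hT₁T, ha, fun t ht => nsRescaleData_eq_lerayBackward (h t ht)⟩

end Local

end Summit.NavierStokesRegularity.FluidComputer.SelfSimilarCensus

end
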